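import Literature.NumberTheory.ComplexMultiplication.CMOrderOverorderInvertibleIdealExtension
import Literature.NumberTheory.ComplexMultiplication.CMOrderLocallyPrincipal
import Literature.NumberTheory.ComplexMultiplication.CMOrderWeakClassesCount
import HarnessLib

/-!
# Weak equivalence IS local isomorphism: MARSEGLIA'S PROPOSITION 4.1 (1) ⟺ (2) ⟺ (3) for an arbitrary order —
# `I_𝔭 ≅ J_𝔭` for every prime `𝔭` ⟺ `1 ∈ (I:J)(J:I)` ⟺ `I = LJ` with `L` invertible (here: `L ∈ 𝓘(𝔯)`), and the
# localisation of colon ideals `(I:J)_𝔭 = (I_𝔭:J_𝔭)`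

Family `hodge`, lane `lit-hodgefound` (Track 2 foundations library; seat p15, row g26-#3), topic
`Literature/NumberTheory/ComplexMultiplication`, namespaces `Literature.NumberTheory.ComplexMultiplication.NumberRing`
(§§1–2: any noetherian domain `R` with fraction field `K` — the localisation of colon ideals and the directions
(1) ⟹ (2), (3) ⟹ (1), (3) ⟹ (2)), `…EndOrder` (§3: the same for `𝔯 = endOrder ρ`) and `…CMTypeLattice` (§4: the
"arbitrary order" series `𝔯 = endOrder (M_μ)`, `K` a number field of any degree: (2) ⟹ (3) WITH `L ∈ 𝓘(𝔯)` through
`Pic(𝔯) ↠ Pic(S)` (`CMOrderOverorderInvertibleIdealExtension`, g26-#1) and the three equivalences).  THEOREMS ONLY: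
no definition, no instance, no named fact (net Literature debt `0`).

`CMOrderWeakEquivalence` (g24-#5) has (2) ⟺ (3) in the form «`I = LJ`, `J = L′I`, `1 ∈ LL′`» and Cor. 4.5; the
LOCAL condition (1) was not formalised there.  Conventions as in that file: weak equivalence is
`1 ∈ I / J * (J / I)` on `FractionalIdeal 𝔯⁰ K`; the local ring `R_𝔭 ⊆ K` is `Localization.subalgebra.ofField`, the
local component `I_𝔭 = span R_𝔭 ↑I` (`CMOrderLocallyPrincipal`, `CMOrderInvertibleIdealLocalization`); «`I_𝔭 ≅ J_𝔭`»
is read as `I_𝔭 = x·J_𝔭` for some `x ∈ K` (Marseglia's Cor. 3.3 «every `R_𝔭`-linear morphism `φ : I_𝔭 → J_𝔭` is a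
multiplication by some `α`», so an isomorphism is `I_𝔭 = xJ_𝔭` — the form in which (1) is USED in the printed proof).

## Source, VERBATIM

S. Marseglia, *Computing the ideal class monoid of an order*, J. Lond. Math. Soc. (2) 101 (2020) 984–1007
[Marseglia2019] (arXiv:1805.09671, held `paper:arxiv-1805.09671`, chunk p0008):
"Proposition 4.1. Let `I` and `J` be two fractional `R`-ideals. The following are equivalent: (1) `I_𝔭` and
`J_𝔭` are isomorphic for every prime `𝔭` of `R`; (2) `1 ∈ (I:J)(J:I)`; (3) `I` and `J` have the same
multiplicator ring, say `S`, and there exists an ideal `L` invertible in `S` such that `I = LJ`.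
Proof. (1)⟹(2): Let `𝔭` be a prime of `R`. By Corollary 3.3 there exists a non-zero divisor `x` in the total
quotient ring of `R_𝔭` such that `I_𝔭 = xJ_𝔭`, which in turn implies that `(I_𝔭:J_𝔭) = (xJ_𝔭:J_𝔭) = x(J_𝔭:J_𝔭)`
and `(J_𝔭:I_𝔭) = (J_𝔭:xJ_𝔭) = (1/x)(J_𝔭:J_𝔭)`. Therefore `((I:J)(J:I))_𝔭 = (I_𝔭:J_𝔭)(J_𝔭:I_𝔭) =
x(J_𝔭:J_𝔭)(1/x)(J_𝔭:J_𝔭) = (J_𝔭:J_𝔭)`, which clearly contains `1`. Hence, the natural inclusion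
`(J:I)(I:J) ⊆ (J:J)` is locally surjective at `𝔭`. Since the choice of `𝔭` was arbitrary we conclude that
`(J:I)(I:J) = (J:J)` and in particular that `1 ∈ (J:I)(I:J)`. […] (3)⟹(1): Let `L′` be any invertible ideal in
`R` such that `L′S = L`. Note that such an `L′` exists since the extension map `Pic(R) → Pic(S)` is surjective, as
we explain in Remark 3.8. The localization `L′_𝔭` at any prime `𝔭` of `R` is principal by Lemma 2.7, say
`L′_𝔭 = xR_𝔭`. Then `I_𝔭 = xJ_𝔭` and hence `I_𝔭 ≃ J_𝔭`."  (chunk p0005, proof of Lemma 2.8: "Since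
`(R:I)_𝔭 = (R_𝔭:I_𝔭)` …".)

## What is formalised

* §1 **`NumberRing.span_coe_div`**: `(I:J)_𝔭 = (I_𝔭:J_𝔭)` — localisation commutes with colon ideals (`J ≠ 0`;
  `R` noetherian so `J` is finitely generated).
* §2 (any noetherian domain) **`NumberRing.one_mem_div_mul_div_of_forall_exists_span_coe_eq`** ((1) ⟹ (2)),
  `exists_ne_zero_span_coe_eq_of_isUnit_mul_eq` ((3) with `L ∈ 𝓘(R)` ⟹ (1): `I_𝔭 = xJ_𝔭` with `L_𝔭 = xR_𝔭`),
  `one_mem_div_mul_div_of_isUnit_mul_eq` ((3) with `L ∈ 𝓘(R)` ⟹ (2)).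
* §3 `EndOrder.span_coe_div`, `EndOrder.one_mem_div_mul_div_of_forall_exists_span_coe_eq` for the order
  `𝔯 = endOrder ρ` (its noetherian instance supplied).
* §4 (`𝔯 = endOrder (M_μ)`) **`CMTypeLattice.exists_isUnit_mul_eq_of_one_mem_div_mul_div`**: (2) ⟹ `I = L₀J`
  with `L₀ ∈ 𝓘(𝔯)` INVERTIBLE IN THE ORDER ITSELF («`L′S = L`», so `I = LJ = L′SJ = L′J`);
  **`one_mem_div_mul_div_iff_exists_isUnit_mul_eq`** ((2) ⟺ (3)′: weak equivalence classes are the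
  `𝓘(𝔯)`-orbits), **`one_mem_div_mul_div_iff_forall_exists_span_coe_eq`** ((2) ⟺ (1)),
  `forall_exists_span_coe_eq_iff_exists_isUnit_mul_eq` ((1) ⟺ (3)′).
-/

open scoped nonZeroDivisors NumberField
open Module FractionalIdeal NumberField

namespace Literature.NumberTheory.ComplexMultiplication

namespace NumberRing

/-! ## §1 Localisation commutes with colon ideals: `(I:J)_𝔭 = (I_𝔭 : J_𝔭)` -/

section Colon

variable {R : Type*} [CommRing R] [IsDomain R] {K : Type*} [Field K] [Algebra R K] [IsFractionRing R K]

/-- `(I:J)_𝔭 ⊆ (I_𝔭 : J_𝔭)` — the easy inclusion, for all fractional ideals of a domain (`J ≠ 0`).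
[cite: Marseglia2019, §2, proof of Lemma 2.8 («`(R:I)_𝔭 = (R_𝔭:I_𝔭)`»), p. 5; §4, proof of Prop. 4.1
(«`((I:J)(J:I))_𝔭 = (I_𝔭:J_𝔭)(J_𝔭:I_𝔭)`»), p. 8] -/
theorem span_coe_div_le {I J : FractionalIdeal R⁰ K} (hJ : J ≠ 0) (𝔭 : Ideal R) [𝔭.IsPrime] :
    Submodule.span (Localization.subalgebra.ofField K 𝔭.primeCompl 𝔭.primeCompl_le_nonZeroDivisors)
        ((I / J : FractionalIdeal R⁰ K) : Set K) ≤
      Submodule.span (Localization.subalgebra.ofField K 𝔭.primeCompl 𝔭.primeCompl_le_nonZeroDivisors) (I : Set K) /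
        Submodule.span (Localization.subalgebra.ofField K 𝔭.primeCompl 𝔭.primeCompl_le_nonZeroDivisors)
          (J : Set K) := by
  refine Submodule.span_le.2 fun y hy ↦ ?_
  rw [SetLike.mem_coe, Submodule.mem_div_iff_forall_mul_mem]
  intro z hz
  induction hz using Submodule.span_induction with
  | mem z hz => exact Submodule.subset_span ((mem_div_iff_of_ne_zero hJ).1 hy z hz)
  | zero => rw [mul_zero]; exact Submodule.zero_mem _
  | add z w _ _ hz hw => rw [mul_add]; exact Submodule.add_mem _ hz hw
  | smul a z _ hz => rw [mul_smul_comm]; exact Submodule.smul_mem _ a hz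

/-- **«`(R:I)_𝔭 = (R_𝔭:I_𝔭)`», «`((I:J)(J:I))_𝔭 = (I_𝔭:J_𝔭)(J_𝔭:I_𝔭)`»: LOCALISATION COMMUTES WITH COLON IDEALS,
`(I:J)_𝔭 = (I_𝔭 : J_𝔭)`**, for fractional ideals `I`, `J ≠ 0` of a noetherian domain (`J` finitely generated: a
common denominator `s ∈ R ∖ 𝔭` clears the finitely many local relations `yj_i ∈ I_𝔭`). [cite: Marseglia2019, §2,
proof of Lemma 2.8, p. 5; §4, proof of Prop. 4.1 ((1) ⟹ (2)), p. 8] -/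
theorem span_coe_div [IsNoetherianRing R] {I J : FractionalIdeal R⁰ K} (hJ : J ≠ 0) (𝔭 : Ideal R) [𝔭.IsPrime] :
    Submodule.span (Localization.subalgebra.ofField K 𝔭.primeCompl 𝔭.primeCompl_le_nonZeroDivisors)
        ((I / J : FractionalIdeal R⁰ K) : Set K) =
      Submodule.span (Localization.subalgebra.ofField K 𝔭.primeCompl 𝔭.primeCompl_le_nonZeroDivisors) (I : Set K) /
        Submodule.span (Localization.subalgebra.ofField K 𝔭.primeCompl 𝔭.primeCompl_le_nonZeroDivisors)
          (J : Set K) := by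
  classical
  set A := Localization.subalgebra.ofField K 𝔭.primeCompl 𝔭.primeCompl_le_nonZeroDivisors with hA
  refine le_antisymm (span_coe_div_le hJ 𝔭) fun x hx ↦ ?_
  rw [Submodule.mem_div_iff_forall_mul_mem] at hx
  -- generators of `J` over `R`
  have hfg : (J : Submodule R K).FG := Module.Finite.iff_fg.1 (by
    haveI := FractionalIdeal.isNoetherian J
    infer_instance)
  obtain ⟨s, hs⟩ := hfg
  -- each `x·j`, `j` a generator, lies in `I_𝔭`: `x·j = (1/z_j)·y_j` with `y_j ∈ I`, `z_j ∈ R ∖ 𝔭`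
  have hloc : ∀ j : K, j ∈ s → ∃ y ∈ I, ∃ z : 𝔭.primeCompl, x * j = IsLocalization.mk' A 1 z • y := by
    intro j hj
    have hxj : x * j ∈ Submodule.span A (I : Set K) :=
      hx j (Submodule.subset_span (show j ∈ (J : Submodule R K) from hs ▸ Submodule.subset_span hj))
    obtain ⟨y, hy, z, hxz⟩ := (IsLocalization.mem_span_iff 𝔭.primeCompl).1 hxj
    rw [← coeToSet_coeToSubmodule, Submodule.span_eq] at hy
    exact ⟨y, hy, z, hxz⟩
  choose! y hy z hxz using hloc
  -- units: `(1/z)·z = 1` in `K` for `z ∈ R ∖ 𝔭`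
  have hunit : ∀ z : 𝔭.primeCompl, ((IsLocalization.mk' A (1 : R) z : A) : K) * algebraMap R K (z : R) = 1 := by
    intro z
    rw [IsScalarTower.algebraMap_apply R A K, show ∀ a : A, algebraMap A K a = (a : K) from fun _ ↦ rfl,
      ← Subalgebra.coe_mul, IsLocalization.mk'_spec, map_one, Subalgebra.coe_one]
  -- common denominator `d = ∏ z_j ∈ R ∖ 𝔭`; `d·x ∈ (I:J)`
  set d : 𝔭.primeCompl := ∏ j ∈ s, z j with hd
  have hdx : algebraMap R K (d : R) * x ∈ ((I / J : FractionalIdeal R⁰ K) : Submodule R K) := by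
    rw [coe_div hJ, Submodule.mem_div_iff_forall_mul_mem]
    intro w hw
    have hw' : w ∈ Submodule.span R (s : Set K) := by rw [hs]; exact hw
    clear hw
    induction hw' using Submodule.span_induction with
    | mem j hj =>
      rw [mul_assoc, hxz j hj, hd, ← Finset.mul_prod_erase s z hj, Submonoid.coe_mul, map_mul, Subalgebra.smul_def,
        smul_eq_mul, show algebraMap R K (z j : R) * algebraMap R K (↑(∏ j ∈ s.erase j, z j)) *
          (((IsLocalization.mk' A (1 : R) (z j) : A) : K) * y j) =
        algebraMap R K (↑(∏ j ∈ s.erase j, z j)) * ((((IsLocalization.mk' A (1 : R) (z j) : A) : K)) *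
          algebraMap R K (z j : R)) * y j by ring, hunit, mul_one, ← Algebra.smul_def]
      exact Submodule.smul_mem _ _ (hy j hj)
    | zero => rw [mul_zero]; exact Submodule.zero_mem _
    | add w w' _ _ ih ih' => rw [mul_add]; exact Submodule.add_mem _ ih ih'
    | smul r w _ ih => rw [mul_smul_comm]; exact Submodule.smul_mem _ r ih
  -- `x = (1/d)·(d·x) ∈ (I:J)_𝔭`
  have hx_eq : x = (IsLocalization.mk' A (1 : R) d : A) • (algebraMap R K (d : R) * x) := by
    rw [Subalgebra.smul_def, smul_eq_mul, ← mul_assoc, hunit, one_mul]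
  rw [hx_eq]
  exact Submodule.smul_mem _ _ (Submodule.subset_span hdx)

end Colon

/-! ## §2 Proposition 4.1: (1) ⟹ (2), and (3) with `L ∈ 𝓘(R)` ⟹ (1), (2) — any noetherian domain -/

section LocalIsomorphism

variable {R : Type*} [CommRing R] [IsDomain R] {K : Type*} [Field K] [Algebra R K] [IsFractionRing R K]

/-- **PROPOSITION 4.1 (1) ⟹ (2): locally isomorphic ideals are weakly equivalent — if `I_𝔭 = x_𝔭·J_𝔭` for
every maximal `𝔭`, then `1 ∈ (I:J)(J:I)`** («`((I:J)(J:I))_𝔭 = (I_𝔭:J_𝔭)(J_𝔭:I_𝔭) = x(J_𝔭:J_𝔭)(1/x)(J_𝔭:J_𝔭) =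
(J_𝔭:J_𝔭)`, which clearly contains `1` … Since the choice of `𝔭` was arbitrary»; globalised by (4-3)), for
nonzero fractional ideals of any noetherian domain. [cite: Marseglia2019, §4 Prop. 4.1 ((1) ⟹ (2)), p. 8]
[cite: DadeTausskyZassenhaus1962, (the integral-domain case, cited through Marseglia2019 §4)] -/
theorem one_mem_div_mul_div_of_forall_exists_span_coe_eq [IsNoetherianRing R] {I J : FractionalIdeal R⁰ K}
    (hI : I ≠ 0) (hJ : J ≠ 0)
    (h : ∀ 𝔭 : MaximalSpectrum R, ∃ x : K,
      Submodule.span (Localization.subalgebra.ofField K 𝔭.asIdeal.primeCompl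
          𝔭.asIdeal.primeCompl_le_nonZeroDivisors) (I : Set K) =
        Submodule.span (Localization.subalgebra.ofField K 𝔭.asIdeal.primeCompl
            𝔭.asIdeal.primeCompl_le_nonZeroDivisors) {x} *
          Submodule.span (Localization.subalgebra.ofField K 𝔭.asIdeal.primeCompl
            𝔭.asIdeal.primeCompl_le_nonZeroDivisors) (J : Set K)) :
    (1 : K) ∈ I / J * (J / I) := by
  rw [← mem_coe, mem_iff_forall_mem_span]
  intro 𝔭
  haveI := 𝔭.isMaximal.isPrime
  set A := Localization.subalgebra.ofField K 𝔭.asIdeal.primeCompl 𝔭.asIdeal.primeCompl_le_nonZeroDivisors with hA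
  obtain ⟨x, hx⟩ := h 𝔭
  -- `x ≠ 0`: `I_𝔭 ∋` a nonzero element of `I`
  have hx0 : x ≠ 0 := by
    rintro rfl
    obtain ⟨a, ha0, haI⟩ := exists_ne_zero_mem_isInteger hI
    have ha : algebraMap R K a ∈ Submodule.span A (I : Set K) := Submodule.subset_span haI
    rw [hx, Submodule.span_singleton_eq_bot.2 rfl, Submodule.bot_mul] at ha
    exact ha0 (IsFractionRing.injective R K (((Submodule.mem_bot _).1 ha).trans (map_zero _).symm))
  rw [coeToSet_coeToSubmodule, span_coe_mul, span_coe_div hJ, span_coe_div hI]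
  -- `x ∈ (I_𝔭 : J_𝔭)` and `x⁻¹ ∈ (J_𝔭 : I_𝔭)`
  have h1 : x ∈ Submodule.span A (I : Set K) / Submodule.span A (J : Set K) := by
    rw [Submodule.mem_div_iff_forall_mul_mem]
    intro w hw
    rw [hx]
    exact Submodule.mul_mem_mul (Submodule.mem_span_singleton_self x) hw
  have h2 : x⁻¹ ∈ Submodule.span A (J : Set K) / Submodule.span A (I : Set K) := by
    rw [Submodule.mem_div_iff_forall_mul_mem]
    intro v hv
    rw [hx] at hv
    refine Submodule.mul_induction_on hv (fun a ha w hw ↦ ?_) fun v v' hv hv' ↦ by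
      rw [mul_add]; exact Submodule.add_mem _ hv hv'
    obtain ⟨t, rfl⟩ := Submodule.mem_span_singleton.1 ha
    rw [Subalgebra.smul_def, smul_eq_mul, show x⁻¹ * ((t : K) * x * w) = (t : K) * (x⁻¹ * x) * w by ring,
      inv_mul_cancel₀ hx0, mul_one, ← smul_eq_mul, ← Subalgebra.smul_def]
    exact Submodule.smul_mem _ t hw
  rw [← mul_inv_cancel₀ hx0]
  exact Submodule.mul_mem_mul h1 h2

/-- **PROPOSITION 4.1 (3) ⟹ (1) for `L ∈ 𝓘(R)`: if `I = LJ` with `L` invertible, then `I_𝔭 = x_𝔭·J_𝔭` for every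
prime `𝔭`, where `L_𝔭 = x_𝔭R_𝔭`** («The localization `L′_𝔭` at any prime `𝔭` of `R` is principal by Lemma 2.7, say
`L′_𝔭 = xR_𝔭`. Then `I_𝔭 = xJ_𝔭` and hence `I_𝔭 ≃ J_𝔭`»). [cite: Marseglia2019, §4 Prop. 4.1 ((3) ⟹ (1)), p. 8] -/
theorem exists_ne_zero_span_coe_eq_of_isUnit_mul_eq {I J L : FractionalIdeal R⁰ K} (hL : IsUnit L)
    (hLJ : L * J = I) (𝔭 : Ideal R) [𝔭.IsPrime] :
    ∃ x : K, x ≠ 0 ∧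
      Submodule.span (Localization.subalgebra.ofField K 𝔭.primeCompl 𝔭.primeCompl_le_nonZeroDivisors) (I : Set K) =
        Submodule.span (Localization.subalgebra.ofField K 𝔭.primeCompl 𝔭.primeCompl_le_nonZeroDivisors) {x} *
          Submodule.span (Localization.subalgebra.ofField K 𝔭.primeCompl 𝔭.primeCompl_le_nonZeroDivisors)
            (J : Set K) := by
  obtain ⟨x, -, hx0, hx⟩ := exists_ne_zero_span_coe_eq_span_singleton hL 𝔭
  exact ⟨x, hx0, by rw [← hLJ, span_coe_mul, hx]⟩

/-- **PROPOSITION 4.1 (3) ⟹ (2) for `L ∈ 𝓘(R)`: `I = LJ` with `L` invertible ⟹ `1 ∈ (I:J)(J:I)`** (`L ⊆ (I:J)`,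
`L⁻¹ ⊆ (J:I)`, `1 ∈ LL⁻¹`). [cite: Marseglia2019, §4 Prop. 4.1 ((3) ⟹ (2)), p. 8] -/
theorem one_mem_div_mul_div_of_isUnit_mul_eq {I J L : FractionalIdeal R⁰ K} (hI : I ≠ 0) (hJ : J ≠ 0)
    (hL : IsUnit L) (hLJ : L * J = I) : (1 : K) ∈ I / J * (J / I) := by
  have hLL : L * L⁻¹ = 1 := (mul_inv_cancel_iff_isUnit K).2 hL
  have hL1 : L ≤ I / J := (le_div_iff_mul_le hJ).2 hLJ.le
  have hL2 : L⁻¹ ≤ J / I := (le_div_iff_mul_le hI).2 (by rw [← hLJ, ← mul_assoc, mul_comm L⁻¹ L, hLL, one_mul])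
  have h1 : (1 : K) ∈ L * L⁻¹ := by rw [hLL]; exact (mem_one_iff _).2 ⟨1, map_one _⟩
  exact mul_le_mul' hL1 hL2 h1

end LocalIsomorphism

end NumberRing

/-! ## §3 The order `𝔯 = endOrder ρ` (any `ρ`, any degree) -/

namespace EndOrder

variable {K : Type} [Field K] [NumberField K]
variable {ι : Type} [Fintype ι] [DecidableEq ι] [Nonempty ι] {ρ : K →ₐ[ℚ] Matrix ι ι ℚ}
variable [IsFractionRing (endOrder ρ) K]

/-- **`(I:J)_𝔭 = (I_𝔭 : J_𝔭)` for the fractional ideals of the order `𝔯 = endOrder ρ`** (`J ≠ 0`; `𝔯` is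
noetherian). [cite: Marseglia2019, §2, proof of Lemma 2.8 («`(R:I)_𝔭 = (R_𝔭:I_𝔭)`»), p. 5; §4, proof of Prop. 4.1,
p. 8] -/
theorem span_coe_div {I J : FractionalIdeal (endOrder ρ)⁰ K} (hJ : J ≠ 0) (𝔭 : Ideal (endOrder ρ)) [𝔭.IsPrime] :
    Submodule.span (Localization.subalgebra.ofField K 𝔭.primeCompl 𝔭.primeCompl_le_nonZeroDivisors)
        ((I / J : FractionalIdeal (endOrder ρ)⁰ K) : Set K) =
      Submodule.span (Localization.subalgebra.ofField K 𝔭.primeCompl 𝔭.primeCompl_le_nonZeroDivisors) (I : Set K) /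
        Submodule.span (Localization.subalgebra.ofField K 𝔭.primeCompl 𝔭.primeCompl_le_nonZeroDivisors)
          (J : Set K) :=
  haveI := CMTypeLattice.isNoetherianRing_endOrder ρ
  NumberRing.span_coe_div hJ 𝔭

/-- **PROPOSITION 4.1 (1) ⟹ (2) for the order `𝔯 = endOrder ρ`: `I_𝔭 = x_𝔭·J_𝔭` for all maximal `𝔭` ⟹
`1 ∈ (I:J)(J:I)`.** [cite: Marseglia2019, §4 Prop. 4.1 ((1) ⟹ (2)), p. 8] -/
theorem one_mem_div_mul_div_of_forall_exists_span_coe_eq {I J : FractionalIdeal (endOrder ρ)⁰ K}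
    (hI : I ≠ 0) (hJ : J ≠ 0)
    (h : ∀ 𝔭 : MaximalSpectrum (endOrder ρ), ∃ x : K,
      Submodule.span (Localization.subalgebra.ofField K 𝔭.asIdeal.primeCompl
          𝔭.asIdeal.primeCompl_le_nonZeroDivisors) (I : Set K) =
        Submodule.span (Localization.subalgebra.ofField K 𝔭.asIdeal.primeCompl
            𝔭.asIdeal.primeCompl_le_nonZeroDivisors) {x} *
          Submodule.span (Localization.subalgebra.ofField K 𝔭.asIdeal.primeCompl
            𝔭.asIdeal.primeCompl_le_nonZeroDivisors) (J : Set K)) :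
    (1 : K) ∈ I / J * (J / I) :=
  haveI := CMTypeLattice.isNoetherianRing_endOrder ρ
  NumberRing.one_mem_div_mul_div_of_forall_exists_span_coe_eq hI hJ h

end EndOrder

/-! ## §4 The series `𝔯 = endOrder (M_μ)`: (2) ⟹ (3) with `L ∈ 𝓘(𝔯)`, and the equivalences (1) ⟺ (2) ⟺ (3)′ -/

namespace CMTypeLattice

variable {K : Type} [Field K] [NumberField K]
variable {ι : Type} [Fintype ι] [DecidableEq ι] (μ : Basis ι ℚ K)
variable [IsFractionRing (endOrder (Algebra.leftMulMatrix μ)) K]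

/-- **PROPOSITION 4.1 (2) ⟹ (3), SHARPENED BY THE PRINTED PROOF OF (3) ⟹ (1): weakly equivalent ideals differ by
an ideal invertible in the ORDER ITSELF — `1 ∈ (I:J)(J:I) ⟹ I = L₀·J` with `L₀ ∈ 𝓘(𝔯)`** («`(I:I) = (I:J)(J:I) =
(J:J)` … `I = LJ` for `L = (I:J)`»; «Let `L′` be any invertible ideal in `R` such that `L′S = L`» — then
`I = LJ = L′SJ = L′J` since `SJ = J`), for the order `𝔯 = endOrder (M_μ)` of a number field of any degree; `L′`
comes from `CMOrderOverorderInvertibleIdealExtension.exists_isUnit_mul_eq_of_mul_div_self_div_eq` (`Pic(𝔯) ↠ Pic(S)`,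
`S = (I:I)` presented as `endOrder (M_ν)` for a `ℤ`-basis `ν` of `I`). [cite: Marseglia2019, §4 Prop. 4.1
((2) ⟹ (3) and proof of (3) ⟹ (1)), p. 8] [cite: DadeTausskyZassenhaus1962, (cited through Marseglia2019 §4)] -/
theorem exists_isUnit_mul_eq_of_one_mem_div_mul_div [Nonempty ι]
    {I J : FractionalIdeal (endOrder (Algebra.leftMulMatrix μ))⁰ K} (hI : I ≠ 0) (hJ : J ≠ 0)
    (h1 : (1 : K) ∈ I / J * (J / I)) :
    ∃ L₀ : FractionalIdeal (endOrder (Algebra.leftMulMatrix μ))⁰ K, IsUnit L₀ ∧ L₀ * J = I := by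
  -- `S = (I:I)`, `L = (I:J)`: `L·(J:I) = S`, `S·L = L`, so `L` lies in the `Pic(S)`-stratum
  have hM0 : I / I ≠ 0 := EndOrder.div_self_ne_zero hI
  have hMM : I / I * (I / I) = I / I := EndOrder.div_self_mul_div_self hI
  have hLL' : I / J * (J / I) = I / I := EndOrder.div_mul_div_eq_div_self_of_one_mem hI hJ h1
  have hML : I / I * (I / J) = I / J :=
    le_antisymm (EndOrder.div_self_mul_div_le hI hJ) fun x hx ↦ by
      rw [← one_mul x]; exact mul_mem_mul (EndOrder.one_mem_div_self hI) hx
  obtain ⟨hS, hinv⟩ := EndOrder.mul_div_self_div_eq_div_self_of_mul_eq hMM hM0 hML hLL'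
  have hL0 : I / J ≠ 0 := fun h ↦ hM0 (by rw [← hLL', h, zero_mul])
  -- `S = (I:I) = endOrder (M_ν)` for a `ℤ`-basis `ν` of `I`
  obtain ⟨ν, hle, hIν⟩ := exists_basis_le_endOrder_and_coe_eq μ hI
  have hP : ((I / I : FractionalIdeal (endOrder (Algebra.leftMulMatrix μ))⁰ K) : Set K) =
      (endOrder (Algebra.leftMulMatrix ν) : Set K) := coe_div_self_eq_coe_endOrder μ hI hIν
  have hLS : ((I / J / (I / J) : FractionalIdeal (endOrder (Algebra.leftMulMatrix μ))⁰ K) : Set K) =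
      (endOrder (Algebra.leftMulMatrix ν) : Set K) := by rw [hS]; exact hP
  -- `Pic(𝔯) ↠ Pic(S)`: `L = L₀·S` with `L₀ ∈ 𝓘(𝔯)`
  obtain ⟨L₀, hL₀, hL₀M⟩ := exists_isUnit_mul_eq_of_mul_div_self_div_eq μ ν hle hP hL0 hLS hinv
  refine ⟨L₀, hL₀, ?_⟩
  -- `I = LJ = L₀SJ = L₀J`
  have hMJ : I / I * J = J := by
    rw [EndOrder.div_self_eq_div_self_of_one_mem hI hJ h1, EndOrder.div_self_mul_self_eq hJ]
  rw [← EndOrder.div_mul_eq_of_one_mem hI hJ h1, ← hL₀M, mul_assoc, hMJ]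

/-- **PROPOSITION 4.1 (2) ⟺ (3)′: `I` and `J` are weakly equivalent iff `I = L₀J` for some `L₀ ∈ 𝓘(𝔯)`** — the
weak equivalence classes of `𝔯 = endOrder (M_μ)` are the orbits of the group of invertible ideals (equivalently of
`Pic(𝔯)`) on the ideal monoid. [cite: Marseglia2019, §4 Prop. 4.1 ((2) ⟺ (3)), p. 8]
[cite: DadeTausskyZassenhaus1962, (cited through Marseglia2019 §4)] -/
theorem one_mem_div_mul_div_iff_exists_isUnit_mul_eq [Nonempty ι]
    {I J : FractionalIdeal (endOrder (Algebra.leftMulMatrix μ))⁰ K} (hI : I ≠ 0) (hJ : J ≠ 0) :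
    (1 : K) ∈ I / J * (J / I) ↔
      ∃ L₀ : FractionalIdeal (endOrder (Algebra.leftMulMatrix μ))⁰ K, IsUnit L₀ ∧ L₀ * J = I :=
  ⟨exists_isUnit_mul_eq_of_one_mem_div_mul_div μ hI hJ,
    fun ⟨_, hL₀, h⟩ ↦ NumberRing.one_mem_div_mul_div_of_isUnit_mul_eq hI hJ hL₀ h⟩

/-- **PROPOSITION 4.1 (1) ⟺ (2): WEAK EQUIVALENCE IS LOCAL ISOMORPHISM — `1 ∈ (I:J)(J:I)` iff `I_𝔭 = x_𝔭·J_𝔭`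
(`x_𝔭 ∈ K^*`) for every maximal ideal `𝔭`** of the order `𝔯 = endOrder (M_μ)`, `K` a number field of any degree.
[cite: Marseglia2019, §4 Prop. 4.1 ((1) ⟺ (2)), p. 8] [cite: DadeTausskyZassenhaus1962, (the integral-domain case,
cited through Marseglia2019 §4)] -/
theorem one_mem_div_mul_div_iff_forall_exists_span_coe_eq [Nonempty ι]
    {I J : FractionalIdeal (endOrder (Algebra.leftMulMatrix μ))⁰ K} (hI : I ≠ 0) (hJ : J ≠ 0) :
    (1 : K) ∈ I / J * (J / I) ↔
      ∀ 𝔭 : MaximalSpectrum (endOrder (Algebra.leftMulMatrix μ)), ∃ x : K, x ≠ 0 ∧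
        Submodule.span (Localization.subalgebra.ofField K 𝔭.asIdeal.primeCompl
            𝔭.asIdeal.primeCompl_le_nonZeroDivisors) (I : Set K) =
          Submodule.span (Localization.subalgebra.ofField K 𝔭.asIdeal.primeCompl
              𝔭.asIdeal.primeCompl_le_nonZeroDivisors) {x} *
            Submodule.span (Localization.subalgebra.ofField K 𝔭.asIdeal.primeCompl
              𝔭.asIdeal.primeCompl_le_nonZeroDivisors) (J : Set K) := by
  constructor
  · intro h1 𝔭
    obtain ⟨L₀, hL₀, h⟩ := exists_isUnit_mul_eq_of_one_mem_div_mul_div μ hI hJ h1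
    haveI := 𝔭.isMaximal.isPrime
    exact NumberRing.exists_ne_zero_span_coe_eq_of_isUnit_mul_eq hL₀ h 𝔭.asIdeal
  · intro h
    haveI := isNoetherianRing_endOrder (Algebra.leftMulMatrix μ)
    exact NumberRing.one_mem_div_mul_div_of_forall_exists_span_coe_eq hI hJ fun 𝔭 ↦
      let ⟨x, _, hx⟩ := h 𝔭; ⟨x, hx⟩

/-- **PROPOSITION 4.1 (1) ⟺ (3)′: `I_𝔭 ≅ J_𝔭` for all `𝔭` iff `I = L₀J` with `L₀ ∈ 𝓘(𝔯)`.**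
[cite: Marseglia2019, §4 Prop. 4.1 ((1) ⟺ (3)), p. 8] -/
theorem forall_exists_span_coe_eq_iff_exists_isUnit_mul_eq [Nonempty ι]
    {I J : FractionalIdeal (endOrder (Algebra.leftMulMatrix μ))⁰ K} (hI : I ≠ 0) (hJ : J ≠ 0) :
    (∀ 𝔭 : MaximalSpectrum (endOrder (Algebra.leftMulMatrix μ)), ∃ x : K, x ≠ 0 ∧
        Submodule.span (Localization.subalgebra.ofField K 𝔭.asIdeal.primeCompl
            𝔭.asIdeal.primeCompl_le_nonZeroDivisors) (I : Set K) =
          Submodule.span (Localization.subalgebra.ofField K 𝔭.asIdeal.primeCompl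
              𝔭.asIdeal.primeCompl_le_nonZeroDivisors) {x} *
            Submodule.span (Localization.subalgebra.ofField K 𝔭.asIdeal.primeCompl
              𝔭.asIdeal.primeCompl_le_nonZeroDivisors) (J : Set K)) ↔
      ∃ L₀ : FractionalIdeal (endOrder (Algebra.leftMulMatrix μ))⁰ K, IsUnit L₀ ∧ L₀ * J = I := by
  rw [← one_mem_div_mul_div_iff_forall_exists_span_coe_eq μ hI hJ, one_mem_div_mul_div_iff_exists_isUnit_mul_eq μ hI hJ]

end CMTypeLattice

end Literature.NumberTheory.ComplexMultiplication
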